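import Summits.RiemannHypothesis.RiemannHypothesis.Theorems.SemilocalNegCertTwoThree
import HarnessLib

/-!
# Semi-local negative certificates: the atoms `2, 3, 4, 5, 7, 8, 9, 11, 13, 16` (enclosures, once and for all)

Cell `rh-explicit` (HOME `run/shared/lean/pub/rh-explicit/`), seat cc-s2-4 gen7 (A4 SEMILOCAL-TABLE, the Lean side).  The
certificates `WeilNegCertS` / `WeilNegCertP` (`SemilocalNegCertAtoms.lean`, `SemilocalNegCertPieces.lean`) consume a
rational atom table `(n, lo, hi, wlo, whi)` and a PROOF that it encloses `log n` and the weight `Λ_S(n)/√n`.  This file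
provides the atoms of every row of the A4 table (`S ⊆ {2, 3, 5, 7, 11, 13}`, windows `b < (log 17)/2`), each with its
enclosure lemma stated for an ARBITRARY `S` containing the atom's prime, so that an instance file only lists its atoms
and discharges `AtomsEnclose.encl` by cases:

* `log 7`, `log 11`, `log 13` to eleven decimals (`log_seven_gt_d11`, …) by Mathlib's method
  `Real.abs_log_sub_add_sum_range_le` (Taylor polynomial of `−log(1−x)`) at `7 = 8(1 − 1/8)` (15 terms),
  `11² = 128(1 − 7/128)` (10 terms), `13 = 16(1 − 3/16)` (17 terms), with `log 2` from `LogTwoBounds` (d20);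
  `log 2`, `log 3`, `log 5` are the tree's / Mathlib's (`logTwoLo20`, `Real.log_three_near_10`, `Real.log_five_near_10`);
* `√5, √7, √8, √11, √13` by squaring sixteen-digit decimals; `√4 = 2`, `√9 = 3`, `√16 = 4`;
* atoms `atomFive … atomSixteen` and the generic enclosure lemmas `atomTwo_encl (h : 2 ∈ S)`, …, `atomSixteen_encl`.

Folklore numerics throughout; nothing here bears on RH.
-/

set_option autoImplicit false
set_option linter.dupNamespace false  -- the mandated namespace repeats `RiemannHypothesis`

noncomputable section

namespace Summit.RiemannHypothesis.RiemannHypothesis.Theorems.SemilocalPolyWitness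

open Real
open Literature.NumberTheory.LFunctions
open Literature.Analysis.SpecialFunctions.Real
open Summit.RiemannHypothesis.RiemannHypothesis.Theorems.MotivicDoor.SemilocalMarkov

/-! ## `log 7`, `log 11`, `log 13` -/

/-- `log 7 > 1.94591014905`. -/
theorem log_seven_gt_d11 : (1.94591014905 : ℝ) < Real.log 7 := by
  have t : |((1 : ℝ) / 8)| < 1 := by rw [abs_of_pos (by norm_num)]; norm_num
  have z := Real.abs_log_sub_add_sum_range_le t 14
  rw [abs_of_pos (by norm_num : (0 : ℝ) < 1 / 8)] at z
  norm_num [Finset.sum_range_succ] at z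
  have e : Real.log (7 / 8) = Real.log 7 - 3 * Real.log 2 := by
    rw [Real.log_div (by norm_num) (by norm_num), show (8 : ℝ) = 2 ^ 3 by norm_num, Real.log_pow]
    push_cast; ring
  rw [e] at z
  have h2 := log_two_gt_d20
  obtain ⟨z1, z2⟩ := abs_le.1 z
  linarith
/-- `log 7 < 1.94591014906`. -/
theorem log_seven_lt_d11 : Real.log 7 < 1.94591014906 := by
  have t : |((1 : ℝ) / 8)| < 1 := by rw [abs_of_pos (by norm_num)]; norm_num
  have z := Real.abs_log_sub_add_sum_range_le t 14
  rw [abs_of_pos (by norm_num : (0 : ℝ) < 1 / 8)] at z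
  norm_num [Finset.sum_range_succ] at z
  have e : Real.log (7 / 8) = Real.log 7 - 3 * Real.log 2 := by
    rw [Real.log_div (by norm_num) (by norm_num), show (8 : ℝ) = 2 ^ 3 by norm_num, Real.log_pow]
    push_cast; ring
  rw [e] at z
  have h2 := log_two_lt_d20
  obtain ⟨z1, z2⟩ := abs_le.1 z
  linarith
/-- `log 11 > 2.39789527279`. -/
theorem log_eleven_gt_d11 : (2.39789527279 : ℝ) < Real.log 11 := by
  have t : |((7 : ℝ) / 128)| < 1 := by rw [abs_of_pos (by norm_num)]; norm_num
  have z := Real.abs_log_sub_add_sum_range_le t 9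
  rw [abs_of_pos (by norm_num : (0 : ℝ) < 7 / 128)] at z
  norm_num [Finset.sum_range_succ] at z
  have e : Real.log (121 / 128) = 2 * Real.log 11 - 7 * Real.log 2 := by
    rw [Real.log_div (by norm_num) (by norm_num), show (121 : ℝ) = 11 ^ 2 by norm_num,
      show (128 : ℝ) = 2 ^ 7 by norm_num, Real.log_pow, Real.log_pow]
    push_cast; ring
  rw [e] at z
  have h2 := log_two_gt_d20
  obtain ⟨z1, z2⟩ := abs_le.1 z
  linarith
/-- `log 11 < 2.39789527280`. -/
theorem log_eleven_lt_d11 : Real.log 11 < 2.39789527280 := by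
  have t : |((7 : ℝ) / 128)| < 1 := by rw [abs_of_pos (by norm_num)]; norm_num
  have z := Real.abs_log_sub_add_sum_range_le t 9
  rw [abs_of_pos (by norm_num : (0 : ℝ) < 7 / 128)] at z
  norm_num [Finset.sum_range_succ] at z
  have e : Real.log (121 / 128) = 2 * Real.log 11 - 7 * Real.log 2 := by
    rw [Real.log_div (by norm_num) (by norm_num), show (121 : ℝ) = 11 ^ 2 by norm_num,
      show (128 : ℝ) = 2 ^ 7 by norm_num, Real.log_pow, Real.log_pow]
    push_cast; ring
  rw [e] at z
  have h2 := log_two_lt_d20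
  obtain ⟨z1, z2⟩ := abs_le.1 z
  linarith
/-- `log 13 > 2.56494935746`. -/
theorem log_thirteen_gt_d11 : (2.56494935746 : ℝ) < Real.log 13 := by
  have t : |((3 : ℝ) / 16)| < 1 := by rw [abs_of_pos (by norm_num)]; norm_num
  have z := Real.abs_log_sub_add_sum_range_le t 16
  rw [abs_of_pos (by norm_num : (0 : ℝ) < 3 / 16)] at z
  norm_num [Finset.sum_range_succ] at z
  have e : Real.log (13 / 16) = Real.log 13 - 4 * Real.log 2 := by
    rw [Real.log_div (by norm_num) (by norm_num), show (16 : ℝ) = 2 ^ 4 by norm_num, Real.log_pow]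
    push_cast; ring
  rw [e] at z
  have h2 := log_two_gt_d20
  obtain ⟨z1, z2⟩ := abs_le.1 z
  linarith
/-- `log 13 < 2.56494935747`. -/
theorem log_thirteen_lt_d11 : Real.log 13 < 2.56494935747 := by
  have t : |((3 : ℝ) / 16)| < 1 := by rw [abs_of_pos (by norm_num)]; norm_num
  have z := Real.abs_log_sub_add_sum_range_le t 16
  rw [abs_of_pos (by norm_num : (0 : ℝ) < 3 / 16)] at z
  norm_num [Finset.sum_range_succ] at z
  have e : Real.log (13 / 16) = Real.log 13 - 4 * Real.log 2 := by
    rw [Real.log_div (by norm_num) (by norm_num), show (16 : ℝ) = 2 ^ 4 by norm_num, Real.log_pow]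
    push_cast; ring
  rw [e] at z
  have h2 := log_two_lt_d20
  obtain ⟨z1, z2⟩ := abs_le.1 z
  linarith

/-! ## Square roots by squaring -/

/-- A rational `r ≥ 0` with `r² ≤ n` is `≤ √n`. -/
theorem ratCast_le_sqrt {r : ℚ} {n : ℝ} (hr : 0 ≤ r) (h : ((r ^ 2 : ℚ) : ℝ) ≤ n) : (r : ℝ) ≤ Real.sqrt n := by
  have hr' : (0 : ℝ) ≤ r := by exact_mod_cast hr
  rw [show (r : ℝ) = Real.sqrt ((r : ℝ) ^ 2) from (Real.sqrt_sq hr').symm]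
  exact Real.sqrt_le_sqrt (by push_cast at h; exact h)
/-- A rational `r ≥ 0` with `n ≤ r²` is `≥ √n`. -/
theorem sqrt_le_ratCast {r : ℚ} {n : ℝ} (hr : 0 ≤ r) (h : n ≤ ((r ^ 2 : ℚ) : ℝ)) : Real.sqrt n ≤ (r : ℝ) := by
  have hr' : (0 : ℝ) ≤ r := by exact_mod_cast hr
  rw [show (r : ℝ) = Real.sqrt ((r : ℝ) ^ 2) from (Real.sqrt_sq hr').symm]
  exact Real.sqrt_le_sqrt (by push_cast at h; exact h)

/-- `2.2360679774997896 ≤ √5 ≤ 2.2360679774997897`. -/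
def sqrtFiveLo : ℚ := 22360679774997896 / 10000000000000000
/-- upper decimal of `√5` -/
def sqrtFiveHi : ℚ := 22360679774997897 / 10000000000000000
/-- `2.6457513110645905 ≤ √7 ≤ 2.6457513110645906`. -/
def sqrtSevenLo : ℚ := 26457513110645905 / 10000000000000000
/-- upper decimal of `√7` -/
def sqrtSevenHi : ℚ := 26457513110645906 / 10000000000000000
/-- `2.82842712474619 ≤ √8 ≤ 2.8284271247461901`. -/
def sqrtEightLo : ℚ := 28284271247461900 / 10000000000000000
/-- upper decimal of `√8` -/
def sqrtEightHi : ℚ := 28284271247461901 / 10000000000000000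
/-- `3.3166247903553998 ≤ √11 ≤ 3.3166247903553999`. -/
def sqrtElevenLo : ℚ := 33166247903553998 / 10000000000000000
/-- upper decimal of `√11` -/
def sqrtElevenHi : ℚ := 33166247903553999 / 10000000000000000
/-- `3.6055512754639892 ≤ √13 ≤ 3.6055512754639893`. -/
def sqrtThirteenLo : ℚ := 36055512754639892 / 10000000000000000
/-- upper decimal of `√13` -/
def sqrtThirteenHi : ℚ := 36055512754639893 / 10000000000000000

/-! ## Decimal enclosures of `log 5`, `log 7`, `log 11`, `log 13` as rationals -/

/-- `1.60943791233 ≤ log 5` (Mathlib `Real.log_five_near_10`). -/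
def logFiveLo : ℚ := 160943791233 / 100000000000
/-- `log 5 ≤ 1.60943791253`. -/
def logFiveHi : ℚ := 160943791253 / 100000000000
/-- `logFiveLo ≤ log 5`. -/
theorem logFiveLo_le : (logFiveLo : ℝ) ≤ Real.log 5 := by
  have h := (abs_sub_le_iff.1 Real.log_five_near_10).2
  rw [logFiveLo]; push_cast; linarith
/-- `log 5 ≤ logFiveHi`. -/
theorem log_five_le_logFiveHi : Real.log 5 ≤ (logFiveHi : ℝ) := by
  have h := (abs_sub_le_iff.1 Real.log_five_near_10).1
  rw [logFiveHi]; push_cast; linarith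
/-- lower decimal of `log 7` -/
def logSevenLo : ℚ := 194591014905 / 100000000000
/-- upper decimal of `log 7` -/
def logSevenHi : ℚ := 194591014906 / 100000000000
/-- lower decimal of `log 11` -/
def logElevenLo : ℚ := 239789527279 / 100000000000
/-- upper decimal of `log 11` -/
def logElevenHi : ℚ := 239789527280 / 100000000000
/-- lower decimal of `log 13` -/
def logThirteenLo : ℚ := 256494935746 / 100000000000
/-- upper decimal of `log 13` -/
def logThirteenHi : ℚ := 256494935747 / 100000000000

/-! ## The atoms and their enclosure lemmas (generic in `S`) -/

/-- The atom `5`: weight `log 5/√5`. -/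
def atomFive : ℕ × AtomQ := (5, ⟨logFiveLo, logFiveHi, logFiveLo / sqrtFiveHi, logFiveHi / sqrtFiveLo⟩)
/-- The atom `7`: weight `log 7/√7`. -/
def atomSeven : ℕ × AtomQ := (7, ⟨logSevenLo, logSevenHi, logSevenLo / sqrtSevenHi, logSevenHi / sqrtSevenLo⟩)
/-- The atom `8 = 2³`: `log 8 = 3 log 2`, weight `log 2/√8`. -/
def atomEight : ℕ × AtomQ := (8, ⟨3 * logTwoLo20, 3 * logTwoHi20, logTwoLo20 / sqrtEightHi, logTwoHi20 / sqrtEightLo⟩)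
/-- The atom `9 = 3²`: `log 9 = 2 log 3`, weight `log 3/3`. -/
def atomNine : ℕ × AtomQ := (9, ⟨2 * logThreeLo, 2 * logThreeHi, logThreeLo / 3, logThreeHi / 3⟩)
/-- The atom `11`: weight `log 11/√11`. -/
def atomEleven : ℕ × AtomQ :=
  (11, ⟨logElevenLo, logElevenHi, logElevenLo / sqrtElevenHi, logElevenHi / sqrtElevenLo⟩)
/-- The atom `13`: weight `log 13/√13`. -/
def atomThirteen : ℕ × AtomQ :=
  (13, ⟨logThirteenLo, logThirteenHi, logThirteenLo / sqrtThirteenHi, logThirteenHi / sqrtThirteenLo⟩)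
/-- The atom `16 = 2⁴`: `log 16 = 4 log 2`, weight `log 2/4`. -/
def atomSixteen : ℕ × AtomQ := (16, ⟨4 * logTwoLo20, 4 * logTwoHi20, logTwoLo20 / 4, logTwoHi20 / 4⟩)

/-- Enclosure of a prime atom from decimal bounds of `log p` and `√p`. -/
theorem prime_atom_encl {S : Finset ℕ} {p : ℕ} (hp : p.Prime) (h : p ∈ S) {lo hi slo shi : ℚ}
    (hlo : (lo : ℝ) ≤ Real.log p) (hhi : Real.log p ≤ (hi : ℝ)) (hlo0 : 0 ≤ lo)
    (hslo : (slo : ℝ) ≤ Real.sqrt p) (hshi : Real.sqrt p ≤ (shi : ℝ)) (hslo0 : 0 < slo) :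
    (lo : ℝ) ≤ Real.log p ∧ Real.log p ≤ (hi : ℝ) ∧
      ((lo / shi : ℚ) : ℝ) ≤ weilSemilocalCoeff S p ∧ weilSemilocalCoeff S p ≤ ((hi / slo : ℚ) : ℝ) := by
  rw [weilSemilocalCoeff_prime_of_mem hp h]
  have hslo0' : (0 : ℝ) < slo := by exact_mod_cast hslo0
  have hlo0' : (0 : ℝ) ≤ lo := by exact_mod_cast hlo0
  push_cast
  refine ⟨hlo, hhi, ?_, ?_⟩
  · exact div_le_div₀ (hlo0'.trans hlo) hlo (hslo0'.trans_le hslo) hshi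
  · exact div_le_div₀ (hlo0'.trans (hlo.trans hhi)) hhi hslo0' hslo

/-- `atomTwo` encloses the atom `2` for any `S ∋ 2`. -/
theorem atomTwo_encl {S : Finset ℕ} (h : 2 ∈ S) :
    (atomTwo.2.lo : ℝ) ≤ Real.log atomTwo.1 ∧ Real.log atomTwo.1 ≤ (atomTwo.2.hi : ℝ) ∧
      (atomTwo.2.wlo : ℝ) ≤ weilSemilocalCoeff S atomTwo.1 ∧ weilSemilocalCoeff S atomTwo.1 ≤ (atomTwo.2.whi : ℝ) := by
  simp only [atomTwo]
  push_cast
  have h0 := prime_atom_encl Nat.prime_two h (lo := logTwoLo20) (hi := logTwoHi20) (slo := sqrtTwoLo)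
    (shi := sqrtTwoHi) (by exact_mod_cast logTwoLo20_le) (by exact_mod_cast log_two_le_logTwoHi20)
    (by rw [logTwoLo20]; norm_num) (by exact_mod_cast sqrtTwoLo_le) (by exact_mod_cast sqrt_two_le_sqrtTwoHi)
    (by rw [sqrtTwoLo]; norm_num)
  push_cast at h0
  exact h0

/-- Enclosure of a prime-power atom `p^m` from decimal bounds of `log p` and of `√(p^m)`. -/
theorem pow_atom_encl_of_bounds {S : Finset ℕ} {p m : ℕ} (hp : p.Prime) (hm : m ≠ 0) (h : p ∈ S)
    {lo hi slo shi : ℚ} (hlo : (lo : ℝ) ≤ Real.log p) (hhi : Real.log p ≤ (hi : ℝ)) (hlo0 : 0 ≤ lo)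
    (hslo : (slo : ℝ) ≤ Real.sqrt ((p ^ m : ℕ) : ℝ)) (hshi : Real.sqrt ((p ^ m : ℕ) : ℝ) ≤ (shi : ℝ))
    (hslo0 : 0 < slo) :
    ((m * lo : ℚ) : ℝ) ≤ Real.log ((p ^ m : ℕ) : ℝ) ∧ Real.log ((p ^ m : ℕ) : ℝ) ≤ ((m * hi : ℚ) : ℝ) ∧
      ((lo / shi : ℚ) : ℝ) ≤ weilSemilocalCoeff S (p ^ m) ∧ weilSemilocalCoeff S (p ^ m) ≤ ((hi / slo : ℚ) : ℝ) := by
  rw [weilSemilocalCoeff_pow_of_mem hp hm h]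
  have hslo0' : (0 : ℝ) < slo := by exact_mod_cast hslo0
  have hlo0' : (0 : ℝ) ≤ lo := by exact_mod_cast hlo0
  push_cast at hslo hshi ⊢
  rw [Real.log_pow]
  refine ⟨by nlinarith, by nlinarith, ?_, ?_⟩
  · exact div_le_div₀ (hlo0'.trans hlo) hlo (hslo0'.trans_le hslo) hshi
  · exact div_le_div₀ (hlo0'.trans (hlo.trans hhi)) hhi hslo0' hslo

/-- `logSevenLo ≤ log 7`. -/
theorem logSevenLo_le : (logSevenLo : ℝ) ≤ Real.log 7 := by
  rw [logSevenLo]; push_cast; linarith [log_seven_gt_d11]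
/-- `log 7 ≤ logSevenHi`. -/
theorem log_seven_le_logSevenHi : Real.log 7 ≤ (logSevenHi : ℝ) := by
  rw [logSevenHi]; push_cast; linarith [log_seven_lt_d11]
/-- `logElevenLo ≤ log 11`. -/
theorem logElevenLo_le : (logElevenLo : ℝ) ≤ Real.log 11 := by
  rw [logElevenLo]; push_cast; linarith [log_eleven_gt_d11]
/-- `log 11 ≤ logElevenHi`. -/
theorem log_eleven_le_logElevenHi : Real.log 11 ≤ (logElevenHi : ℝ) := by
  rw [logElevenHi]; push_cast; linarith [log_eleven_lt_d11]
/-- `logThirteenLo ≤ log 13`. -/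
theorem logThirteenLo_le : (logThirteenLo : ℝ) ≤ Real.log 13 := by
  rw [logThirteenLo]; push_cast; linarith [log_thirteen_gt_d11]
/-- `log 13 ≤ logThirteenHi`. -/
theorem log_thirteen_le_logThirteenHi : Real.log 13 ≤ (logThirteenHi : ℝ) := by
  rw [logThirteenHi]; push_cast; linarith [log_thirteen_lt_d11]
/-- `atomThree` encloses the atom `3` for any `S ∋ 3`. -/
theorem atomThree_encl {S : Finset ℕ} (h : 3 ∈ S) :
    (atomThree.2.lo : ℝ) ≤ Real.log atomThree.1 ∧ Real.log atomThree.1 ≤ (atomThree.2.hi : ℝ) ∧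
      (atomThree.2.wlo : ℝ) ≤ weilSemilocalCoeff S atomThree.1 ∧
      weilSemilocalCoeff S atomThree.1 ≤ (atomThree.2.whi : ℝ) := by
  simp only [atomThree]
  push_cast
  have h0 := prime_atom_encl Nat.prime_three h (lo := logThreeLo) (hi := logThreeHi) (slo := sqrtThreeLo)
    (shi := sqrtThreeHi) (by exact_mod_cast logThreeLo_le) (by exact_mod_cast log_three_le_logThreeHi)
    (by rw [logThreeLo]; norm_num) (by exact_mod_cast sqrtThreeLo_le) (by exact_mod_cast sqrt_three_le_sqrtThreeHi)
    (by rw [sqrtThreeLo]; norm_num)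
  push_cast at h0
  exact h0
/-- `atomFour` encloses the atom `4` for any `S ∋ 2`. -/
theorem atomFour_encl {S : Finset ℕ} (h : 2 ∈ S) :
    (atomFour.2.lo : ℝ) ≤ Real.log atomFour.1 ∧ Real.log atomFour.1 ≤ (atomFour.2.hi : ℝ) ∧
      (atomFour.2.wlo : ℝ) ≤ weilSemilocalCoeff S atomFour.1 ∧
      weilSemilocalCoeff S atomFour.1 ≤ (atomFour.2.whi : ℝ) := by
  simp only [atomFour]
  rw [show (4 : ℕ) = 2 ^ 2 by norm_num]
  have h0 := pow_atom_encl_of_bounds Nat.prime_two two_ne_zero h (lo := logTwoLo20) (hi := logTwoHi20)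
    (slo := 2) (shi := 2) (by exact_mod_cast logTwoLo20_le) (by exact_mod_cast log_two_le_logTwoHi20)
    (by rw [logTwoLo20]; norm_num) (by rw [sqrt_two_sq_cast]; norm_num) (by rw [sqrt_two_sq_cast]; norm_num)
    (by norm_num)
  push_cast at h0 ⊢
  exact h0
/-- `atomFive` encloses the atom `5` for any `S ∋ 5`. -/
theorem atomFive_encl {S : Finset ℕ} (h : 5 ∈ S) :
    (atomFive.2.lo : ℝ) ≤ Real.log atomFive.1 ∧ Real.log atomFive.1 ≤ (atomFive.2.hi : ℝ) ∧
      (atomFive.2.wlo : ℝ) ≤ weilSemilocalCoeff S atomFive.1 ∧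
      weilSemilocalCoeff S atomFive.1 ≤ (atomFive.2.whi : ℝ) := by
  simp only [atomFive]
  push_cast
  have h0 := prime_atom_encl (by norm_num : Nat.Prime 5) h (lo := logFiveLo) (hi := logFiveHi) (slo := sqrtFiveLo)
    (shi := sqrtFiveHi) (by exact_mod_cast logFiveLo_le) (by exact_mod_cast log_five_le_logFiveHi)
    (by rw [logFiveLo]; norm_num) (ratCast_le_sqrt (by rw [sqrtFiveLo]; norm_num) (by rw [sqrtFiveLo]; norm_num))
    (sqrt_le_ratCast (by rw [sqrtFiveHi]; norm_num) (by rw [sqrtFiveHi]; norm_num)) (by rw [sqrtFiveLo]; norm_num)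
  push_cast at h0
  exact h0

/-- `atomSeven` encloses the atom `7` for any `S ∋ 7`. -/
theorem atomSeven_encl {S : Finset ℕ} (h : 7 ∈ S) :
    (atomSeven.2.lo : ℝ) ≤ Real.log atomSeven.1 ∧ Real.log atomSeven.1 ≤ (atomSeven.2.hi : ℝ) ∧
      (atomSeven.2.wlo : ℝ) ≤ weilSemilocalCoeff S atomSeven.1 ∧
      weilSemilocalCoeff S atomSeven.1 ≤ (atomSeven.2.whi : ℝ) := by
  simp only [atomSeven]
  push_cast
  have h0 := prime_atom_encl (by norm_num : Nat.Prime 7) h (lo := logSevenLo) (hi := logSevenHi)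
    (slo := sqrtSevenLo) (shi := sqrtSevenHi) (by exact_mod_cast logSevenLo_le)
    (by exact_mod_cast log_seven_le_logSevenHi) (by rw [logSevenLo]; norm_num)
    (ratCast_le_sqrt (by rw [sqrtSevenLo]; norm_num) (by rw [sqrtSevenLo]; norm_num))
    (sqrt_le_ratCast (by rw [sqrtSevenHi]; norm_num) (by rw [sqrtSevenHi]; norm_num)) (by rw [sqrtSevenLo]; norm_num)
  push_cast at h0
  exact h0

/-- `atomEight` encloses the atom `8` for any `S ∋ 2`. -/
theorem atomEight_encl {S : Finset ℕ} (h : 2 ∈ S) :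
    (atomEight.2.lo : ℝ) ≤ Real.log atomEight.1 ∧ Real.log atomEight.1 ≤ (atomEight.2.hi : ℝ) ∧
      (atomEight.2.wlo : ℝ) ≤ weilSemilocalCoeff S atomEight.1 ∧
      weilSemilocalCoeff S atomEight.1 ≤ (atomEight.2.whi : ℝ) := by
  simp only [atomEight]
  rw [show (8 : ℕ) = 2 ^ 3 by norm_num]
  have e8 : Real.sqrt ((2 ^ 3 : ℕ) : ℝ) = Real.sqrt 8 := by norm_num
  have h0 := pow_atom_encl_of_bounds Nat.prime_two (by norm_num : (3 : ℕ) ≠ 0) h (lo := logTwoLo20)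
    (hi := logTwoHi20) (slo := sqrtEightLo) (shi := sqrtEightHi) (by exact_mod_cast logTwoLo20_le)
    (by exact_mod_cast log_two_le_logTwoHi20) (by rw [logTwoLo20]; norm_num)
    (by rw [e8]; exact ratCast_le_sqrt (by rw [sqrtEightLo]; norm_num) (by rw [sqrtEightLo]; norm_num))
    (by rw [e8]; exact sqrt_le_ratCast (by rw [sqrtEightHi]; norm_num) (by rw [sqrtEightHi]; norm_num))
    (by rw [sqrtEightLo]; norm_num)
  push_cast at h0 ⊢
  exact h0

/-- `atomNine` encloses the atom `9` for any `S ∋ 3`. -/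
theorem atomNine_encl {S : Finset ℕ} (h : 3 ∈ S) :
    (atomNine.2.lo : ℝ) ≤ Real.log atomNine.1 ∧ Real.log atomNine.1 ≤ (atomNine.2.hi : ℝ) ∧
      (atomNine.2.wlo : ℝ) ≤ weilSemilocalCoeff S atomNine.1 ∧
      weilSemilocalCoeff S atomNine.1 ≤ (atomNine.2.whi : ℝ) := by
  simp only [atomNine]
  rw [show (9 : ℕ) = 3 ^ 2 by norm_num]
  have e9 : Real.sqrt ((3 ^ 2 : ℕ) : ℝ) = 3 := by
    rw [show ((3 ^ 2 : ℕ) : ℝ) = (3 : ℝ) ^ 2 by norm_num, Real.sqrt_sq (by norm_num)]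
  have h0 := pow_atom_encl_of_bounds Nat.prime_three two_ne_zero h (lo := logThreeLo) (hi := logThreeHi)
    (slo := 3) (shi := 3) (by exact_mod_cast logThreeLo_le) (by exact_mod_cast log_three_le_logThreeHi)
    (by rw [logThreeLo]; norm_num) (by rw [e9]; norm_num) (by rw [e9]; norm_num) (by norm_num)
  push_cast at h0 ⊢
  exact h0

/-- `atomEleven` encloses the atom `11` for any `S ∋ 11`. -/
theorem atomEleven_encl {S : Finset ℕ} (h : 11 ∈ S) :
    (atomEleven.2.lo : ℝ) ≤ Real.log atomEleven.1 ∧ Real.log atomEleven.1 ≤ (atomEleven.2.hi : ℝ) ∧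
      (atomEleven.2.wlo : ℝ) ≤ weilSemilocalCoeff S atomEleven.1 ∧
      weilSemilocalCoeff S atomEleven.1 ≤ (atomEleven.2.whi : ℝ) := by
  simp only [atomEleven]
  push_cast
  have h0 := prime_atom_encl (by norm_num : Nat.Prime 11) h (lo := logElevenLo) (hi := logElevenHi)
    (slo := sqrtElevenLo) (shi := sqrtElevenHi) (by exact_mod_cast logElevenLo_le)
    (by exact_mod_cast log_eleven_le_logElevenHi) (by rw [logElevenLo]; norm_num)
    (ratCast_le_sqrt (by rw [sqrtElevenLo]; norm_num) (by rw [sqrtElevenLo]; norm_num))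
    (sqrt_le_ratCast (by rw [sqrtElevenHi]; norm_num) (by rw [sqrtElevenHi]; norm_num))
    (by rw [sqrtElevenLo]; norm_num)
  push_cast at h0
  exact h0

/-- `atomThirteen` encloses the atom `13` for any `S ∋ 13`. -/
theorem atomThirteen_encl {S : Finset ℕ} (h : 13 ∈ S) :
    (atomThirteen.2.lo : ℝ) ≤ Real.log atomThirteen.1 ∧ Real.log atomThirteen.1 ≤ (atomThirteen.2.hi : ℝ) ∧
      (atomThirteen.2.wlo : ℝ) ≤ weilSemilocalCoeff S atomThirteen.1 ∧
      weilSemilocalCoeff S atomThirteen.1 ≤ (atomThirteen.2.whi : ℝ) := by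
  simp only [atomThirteen]
  push_cast
  have h0 := prime_atom_encl (by norm_num : Nat.Prime 13) h (lo := logThirteenLo) (hi := logThirteenHi)
    (slo := sqrtThirteenLo) (shi := sqrtThirteenHi) (by exact_mod_cast logThirteenLo_le)
    (by exact_mod_cast log_thirteen_le_logThirteenHi) (by rw [logThirteenLo]; norm_num)
    (ratCast_le_sqrt (by rw [sqrtThirteenLo]; norm_num) (by rw [sqrtThirteenLo]; norm_num))
    (sqrt_le_ratCast (by rw [sqrtThirteenHi]; norm_num) (by rw [sqrtThirteenHi]; norm_num))
    (by rw [sqrtThirteenLo]; norm_num)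
  push_cast at h0
  exact h0

/-- `atomSixteen` encloses the atom `16` for any `S ∋ 2`. -/
theorem atomSixteen_encl {S : Finset ℕ} (h : 2 ∈ S) :
    (atomSixteen.2.lo : ℝ) ≤ Real.log atomSixteen.1 ∧ Real.log atomSixteen.1 ≤ (atomSixteen.2.hi : ℝ) ∧
      (atomSixteen.2.wlo : ℝ) ≤ weilSemilocalCoeff S atomSixteen.1 ∧
      weilSemilocalCoeff S atomSixteen.1 ≤ (atomSixteen.2.whi : ℝ) := by
  simp only [atomSixteen]
  rw [show (16 : ℕ) = 2 ^ 4 by norm_num]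
  have e16 : Real.sqrt ((2 ^ 4 : ℕ) : ℝ) = 4 := by
    rw [show ((2 ^ 4 : ℕ) : ℝ) = (4 : ℝ) ^ 2 by norm_num, Real.sqrt_sq (by norm_num)]
  have h0 := pow_atom_encl_of_bounds Nat.prime_two (by norm_num : (4 : ℕ) ≠ 0) h (lo := logTwoLo20)
    (hi := logTwoHi20) (slo := 4) (shi := 4) (by exact_mod_cast logTwoLo20_le)
    (by exact_mod_cast log_two_le_logTwoHi20) (by rw [logTwoLo20]; norm_num) (by rw [e16]; norm_num)
    (by rw [e16]; norm_num) (by norm_num)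
  push_cast at h0 ⊢
  exact h0

end Summit.RiemannHypothesis.RiemannHypothesis.Theorems.SemilocalPolyWitness

end
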